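import Summits.BirchSwinnertonDyer.BirchSwinnertonDyer.Theorems.GenusKolyvaginAtTwoVisiblePairAtTwoCebotarev
import Literature.NumberTheory.EllipticCurves.SelmerTorsionInclusion
import HarnessLib

/-!
# Route `GenusKolyvaginAtTwo`, LINE 6, KEY crux Q3 (inner statement of stmt-BirchSwinnertonDyer-22137):
# the change of level `ι : H¹(ℚ, ·[2]) → H¹(ℚ, ·[2^M])` respects the strict local conditions, and the
# Čebotarev input `hceb` of the deepening step for the ℚ-pair instance (helper, PROVED; seat
# `bsd-line-gk2-p2` g11)

The deepening step (`Literature/…/HeegnerPointsKolyvaginVisibleDescentDeepeningProofs`: McCallum Prop. 5.2,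
`r = 1`) runs on the level-`2` groups but needs DEEP primes (level `2^M`): its input `hceb` asks for a
Kolyvagin prime `ℓ` of the instance (`kolPrime W K M ℓ`) at which two level-`2` classes `u ∈ H¹(ℚ, E[2])`,
`y₀ ∈ H¹(ℚ, E^{(d_K)}[2])` have NON-ZERO localisation. Cor. 3.2 at level `2^M`
(`VisiblePairAtTwo.input_cebotarev`, p640754) gives this for the embedded pair `(ι u, 0), (0, ι y₀)`,
`ι = torsionH1OfDvd` (`E[2] ↪ E[2^M]`), provided the embedded pair is non-zero and VISIBLE; the
conclusion comes back to level `2` because `ι` maps the strict condition `torsionLocalKer_v` at level `2`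
into the one at level `2^M` (functoriality of `H¹` in compatible pairs):

* `torsionH1OfDvd_mem_torsionLocalKer` — for any Weierstrass curve over a field `K`, any `K`-field `E`
  and `d ∣ n`: **`s ∈ torsionLocalKer_E(d) ⟹ ι s ∈ torsionLocalKer_E(n)`**;
* `torsionH1OfDvd_mem_a₁` / `torsionH1OfDvd_mem_a₂` — the same for the instance's `a₁`, `a₂`;
* `exists_kolPrime_not_mem_of_visible_pair` (`hceb` of the deepening, instance currency) — on the LINE-6
  habitat, for `u`, `y₀` at level `2` with `ι u ≠ 0`, `ι y₀ ≠ 0` and `{ι u, ι y₀}` visible after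
  `rK₁ + rK₂`: **`∀ b ∃ ℓ > b`, `kolPrime W K M ℓ`, `y₀ ∉ a₂ W K 1 ℓ`, `u ∉ a₁ W 1 ℓ`.**

Helper (`--supports` 22137), closes nothing; THEOREMS ONLY, 0 sorry, standard axioms. BSD is not proved by this.

References: [McCallumLMS1991] §3 Cor. 3.2, §5 proof of Prop. 5.2 ((11)–(12)); [SerreGaloisCohomology1997]
I §2.4.
-/

set_option autoImplicit false
set_option linter.dupNamespace false -- tree convention: `Summit.BirchSwinnertonDyer.BirchSwinnertonDyer.Theorems` (summit = sub-problem)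

noncomputable section

open scoped Classical

universe u

namespace Summit.BirchSwinnertonDyer.BirchSwinnertonDyer.Theorems.GenusExact.VisiblePairAtTwo

open WeierstrassCurve NumberField IsDedekindDomain Field Finset Rat.HeightOneSpectrum
open Literature.NumberTheory.EllipticCurves Literature.NumberTheory.GaloisRepresentations
open Literature.NumberTheory.EllipticCurves.KolyvaginDescent

/-! ## §1 `ι : H¹(K, E[d]) → H¹(K, E[n])` respects the strict local kernels -/

section Generic

variable {K : Type u} [Field K] (W : WeierstrassCurve K) (E : Type u) [Field E] [Algebra K E]

/-- **The change of level respects the strict local kernel**: for `d ∣ n`, a `K`-field `E` and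
`s ∈ H¹(K, E[d])` with `s_E = 0` in `H¹(E, E(K̄_E)[d])`, the image `ι s ∈ H¹(K, E[n])` has `(ι s)_E = 0`
in `H¹(E, E(K̄_E)[n])` — both composites `H¹(Γ_K, E[d]) → H¹(Γ_E, E(K̄_E)[n])` are the map of the
compatible pair `(res, E[d] ↪ E[n] → E(K̄_E)[n])` (functoriality, Mathlib `ContinuousCohomology.map_comp`).
[cite: SerreGaloisCohomology1997, I §2.4] -/
theorem torsionH1OfDvd_mem_torsionLocalKer {d n : ℤ} (h : d ∣ n) {s : galH1Torsion W d}
    (hs : s ∈ W.torsionLocalKer E d) : torsionH1OfDvd W h s ∈ W.torsionLocalKer E n := by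
  have hle : AddSubgroup.torsionBy (localPoints W E) d ≤ AddSubgroup.torsionBy (localPoints W E) n :=
    Submodule.torsionBy_le_torsionBy_of_dvd d n h
  change _ = 0 at hs
  change _ = 0
  -- `res_n ∘ ι` as the map of one pair
  have hfac₁ := map_one_eq_comp_of_eq (ContinuousMonoidHom.id (absoluteGaloisGroup K))
    (AddSubgroup.inclusion (geomTorsion_le_of_dvd W h)) (fun _ _ ↦ rfl)
    (resGal (K := K) E) (torsionPointsMap W E n) (torsionPointsMap_smul W E n)
    (Φ := resGal (K := K) E)
    (Ψ := (AddSubgroup.inclusion hle).comp (torsionPointsMap W E d))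
    (fun g P ↦ by
      apply Subtype.ext
      have hP := congrArg Subtype.val (torsionPointsMap_smul W E d g P)
      exact hP)
    rfl (by ext P; rfl)
  -- `ι_E ∘ res_d` as the map of the same pair
  have hfac₂ := map_one_eq_comp_of_eq (resGal (K := K) E) (torsionPointsMap W E d)
    (torsionPointsMap_smul W E d) (ContinuousMonoidHom.id (absoluteGaloisGroup E))
    (AddSubgroup.inclusion hle) (fun _ _ ↦ rfl)
    (Φ := resGal (K := K) E)
    (Ψ := (AddSubgroup.inclusion hle).comp (torsionPointsMap W E d))
    (fun g P ↦ by
      apply Subtype.ext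
      have hP := congrArg Subtype.val (torsionPointsMap_smul W E d g P)
      exact hP)
    rfl rfl
  have hcomp := hfac₁.symm.trans hfac₂
  -- evaluate at `s`
  have happ := congrArg (fun f ↦ (TopModuleCat.Hom.hom f) s) hcomp
  simp only [TopModuleCat.hom_comp, ContinuousLinearMap.comp_apply] at happ
  simp only [LinearMap.toAddMonoidHom_coe, ContinuousLinearMap.coe_coe] at hs ⊢
  change (ContinuousCohomology.map (resGal (K := K) E)
      (resHomOfEquivariant _ (torsionPointsMap W E n) (torsionPointsMap_smul W E n)) 1).hom
      ((ContinuousCohomology.map (ContinuousMonoidHom.id (absoluteGaloisGroup K))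
        (resHomOfEquivariant _ (AddSubgroup.inclusion (geomTorsion_le_of_dvd W h)) (fun _ _ ↦ rfl))
          1).hom s) = 0
  rw [happ]
  change (ContinuousCohomology.map (ContinuousMonoidHom.id (absoluteGaloisGroup E))
      (resHomOfEquivariant _ (AddSubgroup.inclusion hle) (fun _ _ ↦ rfl)) 1).hom
      ((ContinuousCohomology.map (resGal (K := K) E)
        (resHomOfEquivariant _ (torsionPointsMap W E d) (torsionPointsMap_smul W E d)) 1).hom s) = 0
  have hs' : (ContinuousCohomology.map (resGal (K := K) E)
      (resHomOfEquivariant _ (torsionPointsMap W E d) (torsionPointsMap_smul W E d)) 1).hom s = 0 := hs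
  rw [hs', map_zero]

end Generic

/-! ## §2 The instance's strict conditions `a₁`, `a₂` under the change of level `2 → 2^M` -/

section Instance

variable (W : WeierstrassCurve ℚ) [W.IsElliptic] [W.IsGloballyMinimal] (K : Type) [Field K] [NumberField K]

omit [W.IsElliptic] [W.IsGloballyMinimal] in
/-- `2 ∣ 2^M` at the levels of the instance (`lvl 1 ∣ lvl M` for `M ≥ 1`). [folklore] -/
theorem lvl_one_dvd_lvl {M : ℕ} (hM : 1 ≤ M) : lvl 1 ∣ lvl M := by
  unfold lvl
  exact_mod_cast pow_dvd_pow 2 hM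

omit [W.IsElliptic] [W.IsGloballyMinimal] in
/-- **`ι = torsionH1OfDvd` maps `a₁ W 1 ℓ` into `a₁ W M ℓ`** (the strict condition of `E` at the places of
`ℓ`, levels `2` and `2^M`). [cite: McCallumLMS1991, §3 (3)] -/
theorem torsionH1OfDvd_mem_a₁ {M : ℕ} (hM : 1 ≤ M) {ℓ : ℕ} {u : galH1Torsion W (lvl 1)}
    (hu : u ∈ a₁ W 1 ℓ) : torsionH1OfDvd W (lvl_one_dvd_lvl hM) u ∈ a₁ W M ℓ := by
  simp only [a₁, AddSubgroup.mem_iInf] at hu ⊢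
  exact fun v hv ↦ torsionH1OfDvd_mem_torsionLocalKer W _ _ (hu v hv)

omit [W.IsElliptic] [W.IsGloballyMinimal] in
/-- **`ι = torsionH1OfDvd` maps `a₂ W K 1 ℓ` into `a₂ W K M ℓ`** (the strict condition of the twin
`E^{(d_K)}` at the places of `ℓ`, levels `2` and `2^M`). [cite: McCallumLMS1991, §3 (3)] -/
theorem torsionH1OfDvd_mem_a₂ {M : ℕ} (hM : 1 ≤ M) {ℓ : ℕ} {y : galH1Torsion (twin W K) (lvl 1)}
    (hy : y ∈ a₂ W K 1 ℓ) : torsionH1OfDvd (twin W K) (lvl_one_dvd_lvl hM) y ∈ a₂ W K M ℓ := by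
  simp only [a₂, AddSubgroup.mem_iInf] at hy ⊢
  exact fun v hv ↦ torsionH1OfDvd_mem_torsionLocalKer (twin W K) _ _ (hy v hv)

/-! ## §3 The Čebotarev input `hceb` of the deepening, instance currency -/

variable (M : ℕ) {θ : K} (hθ : θ ∉ Set.range (algebraMap ℚ K))
  (hθsq : θ ^ 2 = algebraMap ℚ K ((NumberField.discr K : ℤ) : ℚ))

/-- **The input `hceb` of `KolyvaginDescent.exists_deep_certificate_of_shallow[_of_transfer]` for the
ℚ-pair instance** (McCallum's (11)–(12) realised by Prop. 3.1 / Cor. 3.2): on the LINE-6 habitat, for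
level-`2` classes `u ∈ H¹(ℚ, E[2])`, `y₀ ∈ H¹(ℚ, E^{(d_K)}[2])` whose level-`2^M` images `ι u`, `ι y₀`
(`ι = torsionH1OfDvd`) are non-zero and form a VISIBLE pair (`hvis`: a relation
`rK₁ (a₁ ι u) + rK₂ (a₂ ι y₀) = 0` is trivial termwise), and every `b`: a Kolyvagin prime `ℓ > b` of the
instance (`kolPrime W K M ℓ`) with **`y₀ ∉ a₂ W K 1 ℓ` and `u ∉ a₁ W 1 ℓ`** (`y₀,λ ≠ 0`, `u_λ ≠ 0` at
level `2`). (`input_cebotarev` with `r = 2`, `cs = ((ι u, 0), (0, ι y₀))`, `Nv = (1, 1)`; back to level `2`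
by `torsionH1OfDvd_mem_a₁/a₂`.) [cite: McCallumLMS1991, §3 Cor. 3.2, §5 proof of Prop. 5.2 ((11)–(12))] -/
theorem exists_kolPrime_not_mem_of_visible_pair (hcm : ¬ W.HasCM) (hΔ : W.Δ < 0)
    (hK : IsImaginaryQuadratic K) (hodd : Odd (NumberField.discr K))
    (hns : ¬ IsSquare ((NumberField.discr K : ℚ) * -|W.Δ|))
    (hρ : ∀ n : ℕ, W.HasSurjectiveModNGaloisRep (2 ^ n : ℕ)) [(twin W K).IsElliptic] (hM : 1 ≤ M)
    (u : galH1Torsion W (lvl 1)) (y₀ : galH1Torsion (twin W K) (lvl 1))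
    (hu0 : torsionH1OfDvd W (lvl_one_dvd_lvl hM) u ≠ 0)
    (hy0 : torsionH1OfDvd (twin W K) (lvl_one_dvd_lvl hM) y₀ ≠ 0)
    (hvis : ∀ a₁' a₂' : ℤ, rK₁ W K M (a₁' • torsionH1OfDvd W (lvl_one_dvd_lvl hM) u) +
      rK₂ W M hθ hθsq (a₂' • torsionH1OfDvd (twin W K) (lvl_one_dvd_lvl hM) y₀) = 0 →
      a₁' • torsionH1OfDvd W (lvl_one_dvd_lvl hM) u = 0 ∧
        a₂' • torsionH1OfDvd (twin W K) (lvl_one_dvd_lvl hM) y₀ = 0)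
    (b : ℕ) :
    ∃ ℓ, b < ℓ ∧ kolPrime W K M ℓ ∧ y₀ ∉ a₂ W K 1 ℓ ∧ u ∉ a₁ W 1 ℓ := by
  set ιu := torsionH1OfDvd W (lvl_one_dvd_lvl hM) u with hιu
  set ιy := torsionH1OfDvd (twin W K) (lvl_one_dvd_lvl hM) y₀ with hιy
  -- the pure pair `((ι u, 0), (0, ι y₀))` with `Nv = (1, 1)`
  set cs : Fin 2 → galH1Torsion W (lvl M) × galH1Torsion (twin W K) (lvl M) :=
    ![(ιu, 0), (0, ιy)] with hcs
  have hcs0 : cs 0 = (ιu, 0) := rfl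
  have hcs1 : cs 1 = (0, ιy) := rfl
  have h0 : ∀ i, cs i ≠ 0 := by
    intro i
    fin_cases i
    · exact fun h ↦ hu0 (by simpa [hcs0] using congrArg Prod.fst h)
    · exact fun h ↦ hy0 (by simpa [hcs1] using congrArg Prod.snd h)
  have hNv : ∀ i : Fin 2, (fun _ : Fin 2 ↦ (1 : ℕ)) i ≠ 0 →
      ((2 : ℤ) ^ ((fun _ : Fin 2 ↦ (1 : ℕ)) i - 1)) • cs i ≠ 0 := by
    intro i _
    rw [Nat.sub_self, pow_zero, one_zsmul]
    exact h0 i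
  have hpure : ∀ i, (cs i).2 = 0 ∨ (cs i).1 = 0 := by
    intro i
    fin_cases i
    · exact Or.inl rfl
    · exact Or.inr rfl
  have hind : ∀ a : Fin 2 → ℤ, ∑ i, a i • (rK₁ W K M (cs i).1 + rK₂ W M hθ hθsq (cs i).2) = 0 →
      ∀ i, a i • cs i = 0 := by
    intro a ha i
    rw [Fin.sum_univ_two, hcs0, hcs1] at ha
    simp only [map_zero, add_zero, zero_add, ← map_zsmul] at ha
    obtain ⟨h₁, h₂⟩ := hvis (a 0) (a 1) ha
    fin_cases i
    · change a 0 • cs 0 = 0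
      rw [hcs0, Prod.smul_mk, zsmul_zero, h₁]; rfl
    · change a 1 • cs 1 = 0
      rw [hcs1, Prod.smul_mk, zsmul_zero, h₂]; rfl
  obtain ⟨ℓ, hbℓ, hkol, hloc⟩ := input_cebotarev W K M hθ hθsq hcm hΔ hK hodd hns hρ hM 2 cs
    (fun _ ↦ 1) h0 hNv hpure hind b
  refine ⟨ℓ, hbℓ, hkol, fun hy ↦ ?_, fun hu ↦ ?_⟩
  · have h := (hloc 1).2 one_ne_zero
    rw [Nat.sub_self, pow_zero, one_zsmul, hcs1] at h
    exact h (AddSubgroup.mem_prod.mpr ⟨AddSubgroup.zero_mem _, torsionH1OfDvd_mem_a₂ W K hM hy⟩)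
  · have h := (hloc 0).2 one_ne_zero
    rw [Nat.sub_self, pow_zero, one_zsmul, hcs0] at h
    exact h (AddSubgroup.mem_prod.mpr ⟨torsionH1OfDvd_mem_a₁ W hM hu, AddSubgroup.zero_mem _⟩)

end Instance

end Summit.BirchSwinnertonDyer.BirchSwinnertonDyer.Theorems.GenusExact.VisiblePairAtTwo

end
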